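import Mathlib
import Literature.Analysis.FluidPDE.HardSpherePhaseSpace
import Literature.Analysis.FluidPDE.HardSphereRegularGeometry
import Literature.Analysis.FluidPDE.BoltzmannEquationProofs
import Literature.Probability.Entropy.EntropyInequality

/-!
# Sketch — crux-ideate round 1, ideator 2, crux `JParityClosure.OddContactSymmetry`
(stmt-AtomisticToContinuum-13078)

First lemmas of the two idea cards filed by this seat:

* card `cross-swap-kinetic-entropy`: `crossMark_crossSwap` (the velocity CROSS-SWAP
  `S_n (v, w) = (w′, v′)` flips the sign of the ordered-pair-symmetrised J-odd mark — pure algebra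
  of `reflectVel`, PROVED) and `crossSwapParity` (under ANY product velocity law `h₁ ⊗ h₂` the
  symmetrised J-odd mark reweighted by the cross-swap cocycle
  `1 + h₁(w′)h₂(v′)/(h₁(v)h₂(w))` integrates to ZERO — the finite-`N`, every-reference version of
  "`1 + e^{-F}` kills the `f`-dependence"; PROVED from the tree's unit-Jacobian change of
  variables `integral_comp_collideSwap`). `KineticReferenceTransfer` records, as a `Prop`, the
  shape of the transfer step (entropy inequality for events, tree fact
  `Literature.Probability.Entropy.KipnisLandim1999_A1_8_2`, already `_holds`).
* card `odd-dominates-even-causal-slaving`: `oddEvenFactorisation` (pointwise: the odd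
  integrand squared factorises as (odd weight) × (even production density), the scalar core of
  `|O| ≤ Γ̃_a √E`; stated as a `Prop` with its proof obligation isolated in `tanh_half_log_div`)
  and `OddDominatesEven` (the integrated Cauchy–Schwarz form, `Prop`).

Nothing here is filed to the tree; it only has to elaborate (`lean check` rc 0).
-/

noncomputable section

open MeasureTheory Metric Real
open scoped InnerProductSpace

namespace Summit.AtomisticToContinuum.HydrodynamicLimit.Cruxes.OddContactSymmetry.IdeatorTwo

open Literature.Analysis.FluidPDE (reflectVel reflectVel_neg reflectVel_swap reflectVel_eq_collide
  integral_comp_collideSwap)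
open Literature.MathematicalPhysics.KineticTheory (collide)

/-- Velocity space. -/
abbrev V3 : Type := EuclideanSpace ℝ (Fin 3)

/-- J-oddness of a collision mark, VERBATIM the hypothesis of `OddContactSymmetry`:
`Ψ(−n̂, v′, w′) = −Ψ(n̂, v, w)` for `‖n̂‖ = 1`, `(v′, w′) = reflectVel n̂ (v, w)`. -/
def IsJOdd (Ψ : V3 × V3 × V3 → ℝ) : Prop :=
  ∀ (n v w : V3), ‖n‖ = 1 →
    Ψ (-n, (reflectVel n (v, w)).1, (reflectVel n (v, w)).2) = -Ψ (n, v, w)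

/-- The ordered-pair-symmetrised mark at contact normal `n`: the crux's double sum over ordered
pairs `(i, j)`, `(j, i)` contributes `Ψ(n, v, w) + Ψ(−n, w, v)` per unordered colliding pair. -/
def crossMark (Ψ : V3 × V3 × V3 → ℝ) (n : V3) (p : V3 × V3) : ℝ :=
  Ψ (n, p.1, p.2) + Ψ (-n, p.2, p.1)

/-- The velocity CROSS-SWAP at normal `n`: particle 1 receives the post-collisional velocity of
particle 2 and vice versa, `S_n (v, w) = (w′, v′)`. It is the tree's unit-Jacobian change of
variables `p ↦ (collide ω p).swap` (`measurePreserving_collideSwap`). -/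
def crossSwap (n : V3) (p : V3 × V3) : V3 × V3 :=
  ((reflectVel n p).2, (reflectVel n p).1)

/-- The cross-swap is an involution. [reflectVel_swap + reflectVel_reflectVel] -/
theorem crossSwap_crossSwap (n : V3) (p : V3 × V3) : crossSwap n (crossSwap n p) = p := by
  unfold crossSwap
  rw [reflectVel_swap n (reflectVel n p), Literature.Analysis.FluidPDE.reflectVel_reflectVel]

/-- The cross-swap conserves the pair's momentum … -/
theorem crossSwap_fst_add_snd (n : V3) (p : V3 × V3) :
    (crossSwap n p).1 + (crossSwap n p).2 = p.1 + p.2 := by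
  unfold crossSwap
  rw [add_comm]
  exact Literature.Analysis.FluidPDE.reflectVel_fst_add_reflectVel_snd n p

/-- … and its kinetic energy (so it leaves every local Gibbs / Maxwellian pair weight and the
empirical conserved fields at the pair's location unchanged). -/
theorem crossSwap_energy (n : V3) (p : V3 × V3) :
    ‖(crossSwap n p).1‖ ^ 2 + ‖(crossSwap n p).2‖ ^ 2 = ‖p.1‖ ^ 2 + ‖p.2‖ ^ 2 := by
  unfold crossSwap
  rw [add_comm]
  exact Literature.Analysis.FluidPDE.norm_sq_reflectVel_fst_add_norm_sq_reflectVel_snd n p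

/-- **The cross-swap implements J on the symmetrised mark**: for a J-odd `Ψ` and a unit normal,
`crossMark Ψ n ∘ S_n = −crossMark Ψ n`. (The `(i,j)`-term at `S_n p` is the J-image of the
`(j,i)`-term at `p` and vice versa.) PROVED. -/
theorem crossMark_crossSwap {Ψ : V3 × V3 × V3 → ℝ} (hΨ : IsJOdd Ψ) {n : V3} (hn : ‖n‖ = 1)
    (p : V3 × V3) : crossMark Ψ n (crossSwap n p) = -crossMark Ψ n p := by
  have h1 := hΨ n p.1 p.2 hn
  have h2 := hΨ (-n) p.2 p.1 (by rw [norm_neg]; exact hn)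
  rw [neg_neg, reflectVel_neg, reflectVel_swap n p] at h2
  simp only [crossMark, crossSwap, Prod.mk.eta] at h1 h2 ⊢
  rw [h1, h2]
  ring

/-- **CrossSwapParity (first lemma of card `cross-swap-kinetic-entropy`).** Under ANY product
velocity law with positive densities `h₁ ⊗ h₂` (no Maxwellian, no equality of the two laws, no
position structure involved), the symmetrised J-odd mark reweighted by the cross-swap cocycle
integrates to zero:
`∫∫ crossMark Ψ ω (v,w) · [h₁(v)h₂(w) + h₁(w′)h₂(v′)] dv dw = 0`.
With `h₁ = h₂ = h` the bracket is `h(v)h(w)(1 + e^{-F})`, `F = log[h(v)h(w)/(h(v′)h(w′))]` — the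
crux's reweighting. PROVED (change of variables `integral_comp_collideSwap`, unit Jacobian). -/
theorem crossSwapParity {Ψ : V3 × V3 × V3 → ℝ} (hΨ : IsJOdd Ψ) (ω : sphere (0 : V3) 1)
    (h₁ h₂ : V3 → ℝ) :
    ∫ p, crossMark Ψ (ω : V3) p *
        (h₁ p.1 * h₂ p.2 + h₁ (crossSwap (ω : V3) p).1 * h₂ (crossSwap (ω : V3) p).2)
      ∂((volume : Measure V3).prod volume) = 0 := by
  set G : V3 × V3 → ℝ := fun p => crossMark Ψ (ω : V3) p *
    (h₁ p.1 * h₂ p.2 + h₁ (crossSwap (ω : V3) p).1 * h₂ (crossSwap (ω : V3) p).2) with hG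
  have hω : ‖(ω : V3)‖ = 1 := norm_eq_of_mem_sphere ω
  -- the cross-swap is the tree's `(collide ω ·).swap`
  have hS : ∀ p : V3 × V3, crossSwap (ω : V3) p = (collide ω p).swap := by
    intro p
    simp only [crossSwap, reflectVel_eq_collide, Prod.swap]
  -- `G ∘ S = -G`
  have hanti : ∀ p : V3 × V3, G (collide ω p).swap = -G p := by
    intro p
    have hp : (collide ω p).swap = crossSwap (ω : V3) p := (hS p).symm
    rw [hp]
    simp only [hG, crossMark_crossSwap hΨ hω, crossSwap_crossSwap]
    ring
  have hcov := integral_comp_collideSwap ω G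
  have hneg : ∫ p, G (collide ω p).swap ∂((volume : Measure V3).prod volume) =
      -∫ p, G p ∂((volume : Measure V3).prod volume) := by
    rw [← integral_neg]
    exact integral_congr_ae (ae_of_all _ fun p => hanti p)
  have : ∫ p, G p ∂((volume : Measure V3).prod volume) = 0 := by linarith
  simpa [hG] using this

/-- The TRANSFER step of card `cross-swap-kinetic-entropy`, recorded as a shape (it is the tree
fact `KipnisLandim1999_A1_8_2`, proved there as `_holds`): an event that is exponentially rare
under a reference `ν_N` at speed `N` is negligible under any `μ_N` at relative entropy `o(N)`
from `ν_N`. In the line, `ν_N` = the KINETIC reference (hard-core Gibbs positions ⊗ independent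
velocities with the true one-body laws), the event = {|fixed-time odd tube statistic| > η}, which
`crossSwapParity` centres under `ν_N` and static cluster bounds concentrate. -/
def KineticReferenceTransfer : Prop :=
  ∀ (Ω : ℕ → Type) [∀ N, MeasurableSpace (Ω N)] (μ ν : ∀ N, Measure (Ω N))
    [∀ N, IsProbabilityMeasure (μ N)] [∀ N, IsProbabilityMeasure (ν N)] (B : ∀ N, Set (Ω N)),
    (∀ N, MeasurableSet (B N)) →
    (∃ c : ℝ, 0 < c ∧ ∀ᶠ N : ℕ in Filter.atTop,
        (ν N (B N)).toReal ≤ Real.exp (-c * (N + 1))) →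
    (∀ N, ν N (B N) ≠ 0) →
    Filter.Tendsto (fun N : ℕ => (InformationTheory.klDiv (μ N) (ν N)).toReal / (N + 1))
        Filter.atTop (nhds 0) →
    (∀ N, InformationTheory.klDiv (μ N) (ν N) ≠ ⊤) →
    Filter.Tendsto (fun N : ℕ => (μ N (B N)).toReal) Filter.atTop (nhds 0)

/-! ## Card `odd-dominates-even-causal-slaving`: the Cauchy–Schwarz form of the H-split -/

/-- The odd/even weight `Θ(F) = F·coth(F/2) = F (1 + e^{-F})/(1 - e^{-F})` (`= 2` at `F = 0`),
`Θ ≥ 2`; Lean's junk value `F / tanh(F/2) = 0` at `F = 0` is harmless below (both sides vanish). -/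
def thetaWeight (F : ℝ) : ℝ := F / Real.tanh (F / 2)

/-- Scalar core: for `a, b > 0` and `F = log(a/b)`, `tanh(F/2) = (a - b)/(a + b)`. -/
def TanhHalfLogDiv : Prop :=
  ∀ a b : ℝ, 0 < a → 0 < b → Real.tanh (Real.log (a / b) / 2) = (a - b) / (a + b)

/-- Pointwise FACTORISATION behind `|O| ≤ Γ̃_a √E`: with `a = hh_*`, `b = h′h′_*`,
`F = log(a/b)`, the odd integrand `γ_a (a + b) F` satisfies
`(γ_a (a+b) F)² = [γ_a²/γ_s · (a+b) Θ(F)] · [γ_s (a−b) F]` (`γ_s > 0`; both factors ≥ 0 since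
`(a−b)F ≥ 0` and `Θ ≥ 2`). Cauchy–Schwarz after integration against `B dλ` gives
`|O| ≤ Γ̃_a · √E`, `Γ̃_a² = ∫ (γ_a²/γ_s) B (hh_*+h′h′_*) Θ(F)`, `E = ∫ γ_s B (hh_* − h′h′_*) F`
(the even production of ParitySplit, stmt-13083). -/
def OddEvenFactorisation : Prop :=
  ∀ γa γs a b : ℝ, 0 < γs → 0 < a → 0 < b → a ≠ b →
    (γa * (a + b) * Real.log (a / b)) ^ 2 =
      (γa ^ 2 / γs * ((a + b) * thetaWeight (Real.log (a / b)))) * (γs * ((a - b) * Real.log (a / b)))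

/-- **OddDominatesEven (first lemma of card `odd-dominates-even-causal-slaving`)**, integrated
form over an abstract contact space `(X, λ)` carrying the flux weight inside `a, b`
(`a = B·hh_*`, `b = B·h′h′_*` pointwise): the odd channel is bounded by the weighted-L² size of
the RELATIVE odd correlation times the square root of the even production,
`|∫ γ_a (a+b) F| ≤ (∫ γ_a²/γ_s (a+b) Θ(F))^{1/2} (∫ γ_s (a−b) F)^{1/2}`.
With collisional balance `∫(E + O) → 0` this yields `⟨E⟩ ≤ ⟨Γ̃_a²⟩ + o(1)`: even production is
at most the SQUARE of the odd correlation — the quantitative form of "γ_a is the only channel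
that can cancel Boltzmann's production". -/
def OddDominatesEven : Prop :=
  ∀ (X : Type) [MeasurableSpace X] (lam : Measure X) (γa γs a b : X → ℝ),
    (∀ x, 0 < γs x) → (∀ x, 0 < a x) → (∀ x, 0 < b x) →
    Integrable (fun x => γa x ^ 2 / γs x * ((a x + b x) * thetaWeight (Real.log (a x / b x)))) lam →
    Integrable (fun x => γs x * ((a x - b x) * Real.log (a x / b x))) lam →
    |∫ x, γa x * (a x + b x) * Real.log (a x / b x) ∂lam| ≤
      Real.sqrt (∫ x, γa x ^ 2 / γs x * ((a x + b x) * thetaWeight (Real.log (a x / b x))) ∂lam) *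
        Real.sqrt (∫ x, γs x * ((a x - b x) * Real.log (a x / b x)) ∂lam)

end Summit.AtomisticToContinuum.HydrodynamicLimit.Cruxes.OddContactSymmetry.IdeatorTwo

end
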